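import Summits.ResolutionOfSingularities.KangarooAtlas.MizutaniRationalPoint
import HarnessLib

/-!
# `k^{1/q}`-rational points: the characterisation by `cdim = 1` and the DUALITY of invariant additive forms

Cell `pub-rosobs`, Mizutani enclosure (seat mizutani-encloser-2, gen 6). AI-written; AI review is weaker than expert
review; NOT a resolution-of-singularities theorem (summit relevance C).

Sequel of `MizutaniRationalPoint.lean` (`ratPoint k p e c = [c_0^{1/q} : ⋯ : c_n^{1/q}]`, `q = p^e`).  Mizutani 1973 introduces
(Def. 2.2, Lemma 2.3 = Oda's Lemma 2.8, Prop. 2.5) the DUAL H-scheme `H* = H(V*, W*)` of an H-scheme `H = H(V, W)` of exponent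
`e ≥ 1`: the coordinates of the point and the coefficients of the invariant additive forms play symmetric roles.  For the
`k^{1/q}`-rational points this symmetry is literally an identity of the tree's tensor dictionary, and this file proves it:

* the tensor flip: `lmul'_comm`, `comm_mem_ideal_iff`, `map_comm_ideal`, **`comm_mem_ideal_pow_iff`** — the powers `J^m` of the
  diagonal ideal of `S ⊗_R S` are stable under `x ⊗ y ↦ y ⊗ x`;
* `C_mul_X_pow_sub_mem_ratPoint` (`c_j X_i^q − c_i X_j^q ∈ ratPoint c`: the `q`-th powers `ξ_i^q` of the coordinates are
  `k`-proportional to `c`, i.e. `cdim = 1`) and the CHARACTERISATION **`eq_ratPoint_of_forall_sub_mem`**: a point `𝔭` of `ℙ^n_k`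
  containing all `c_j X_i^q − c_i X_j^q` (`c ≠ 0`) IS `ratPoint k p e c` — via the Frobenius identity
  `χ_c(f) · ξ_{i₀}^{qd} = c_{i₀}^d · f(ξ)^q` for forms `f` of degree `d` (`ratChi_mul_pow_eq`);
* **DUALITY `mem_invForms_ratPoint_comm`**: for all vectors `a, c ∈ k^{n+1}` and every `e`,
  `a ∈ (L_B)_e(ratPoint k p e c) ↔ c ∈ (L_B)_e(ratPoint k p e a)` — the additive form `Σ a_i X_i^q` is an invariant form of the
  Hironaka scheme of the point `[c^{1/q}]` iff `Σ c_i X_i^q` is one of the scheme of `[a^{1/q}]` (both say `Σ a_i ⊗ c_i ∈ J^q`);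
  `mem_invForms_ratPoint_comm'` (one Frobenius twist up) and the self-duality of Mizutani's example
  `attC_mem_invForms_ratPoint_attA0` (the coordinate vector of `H_e`'s point is an invariant form of the point of `H_e`'s form).

## References

* H. Mizutani, *Hironaka's additive group schemes*, Nagoya Math. J. 52 (1973) 85–95, Def. 2.2, Lemma 2.3, Prop. 2.5, Lemma 2.7, Thm. 2.8.
  [Mizutani1973HironakaGroupSchemes]
* T. Oda, *Hironaka's additive group scheme, II*, Publ. RIMS 19 (1983), §2 (p. 1168), Thm. 3.1. [Oda1983HironakaGroupSchemeII]
-/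

noncomputable section

open MvPolynomial TensorProduct Literature.AlgebraicGeometry.Resolution
  Literature.AlgebraicGeometry.Resolution.HironakaScheme

namespace Summit.ResolutionOfSingularities.KangarooAtlas.Mizutani

universe u

/-! ## The flip `x ⊗ y ↦ y ⊗ x` preserves the powers of the diagonal ideal -/

section Flip

variable {R : Type*} {S : Type*} [CommRing R] [CommRing S] [Algebra R S]

/-- The multiplication map is symmetric: `μ(flip ω) = μ(ω)`. [folklore] -/
theorem lmul'_comm (ω : S ⊗[R] S) :
    Algebra.TensorProduct.lmul' R (S := S) (Algebra.TensorProduct.comm R S S ω) =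
      Algebra.TensorProduct.lmul' R (S := S) ω := by
  induction ω using TensorProduct.induction_on with
  | zero => rw [map_zero, map_zero]
  | tmul a b =>
    rw [Algebra.TensorProduct.comm_tmul, Algebra.TensorProduct.lmul'_apply_tmul,
      Algebra.TensorProduct.lmul'_apply_tmul, mul_comm]
  | add x y hx hy => rw [map_add, map_add, map_add, hx, hy]

/-- The flip is an involution: `flip (flip ω) = ω`. [folklore] -/
theorem comm_comm (ω : S ⊗[R] S) :
    Algebra.TensorProduct.comm R S S (Algebra.TensorProduct.comm R S S ω) = ω := by
  conv_lhs => rw [← Algebra.TensorProduct.comm_symm R S S]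
  exact (Algebra.TensorProduct.comm R S S).symm_apply_apply ω

/-- The diagonal ideal `J = ker μ` is stable under the flip. [folklore] -/
theorem comm_mem_ideal_iff (ω : S ⊗[R] S) :
    Algebra.TensorProduct.comm R S S ω ∈ KaehlerDifferential.ideal R S ↔ ω ∈ KaehlerDifferential.ideal R S := by
  change _ ∈ RingHom.ker _ ↔ _ ∈ RingHom.ker _
  rw [RingHom.mem_ker, RingHom.mem_ker]
  exact Eq.congr_left (lmul'_comm ω)

/-- `flip(J) = J` as ideals. [folklore] -/
theorem map_comm_ideal :
    Ideal.map (Algebra.TensorProduct.comm R S S) (KaehlerDifferential.ideal R S) = KaehlerDifferential.ideal R S := by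
  apply le_antisymm
  · rw [Ideal.map_le_iff_le_comap]
    intro ω hω
    exact (comm_mem_ideal_iff ω).mpr hω
  · intro ω hω
    rw [← comm_comm ω]
    exact Ideal.mem_map_of_mem _ ((comm_mem_ideal_iff ω).mpr hω)

/-- **The powers `J^m` of the diagonal ideal of `S ⊗_R S` are stable under the flip `x ⊗ y ↦ y ⊗ x`.** [folklore] -/
theorem comm_mem_ideal_pow_iff (m : ℕ) (ω : S ⊗[R] S) :
    Algebra.TensorProduct.comm R S S ω ∈ KaehlerDifferential.ideal R S ^ m ↔
      ω ∈ KaehlerDifferential.ideal R S ^ m := by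
  have key : ∀ ω : S ⊗[R] S, ω ∈ KaehlerDifferential.ideal R S ^ m →
      Algebra.TensorProduct.comm R S S ω ∈ KaehlerDifferential.ideal R S ^ m := fun ω h => by
    have h' := Ideal.mem_map_of_mem (Algebra.TensorProduct.comm R S S) h
    rwa [Ideal.map_pow, map_comm_ideal] at h'
  refine ⟨fun h => ?_, key ω⟩
  have h2 := key _ h
  rwa [comm_comm] at h2

end Flip

/-! ## `cdim = 1` characterises the `k^{1/q}`-rational points -/

section Characterisation

variable {k : Type u} [Field k] {p e : ℕ} [hp : Fact p.Prime] [CharP k p] {n : ℕ} {c : Fin (n + 1) → k}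

/-- **`c_j X_i^q − c_i X_j^q ∈ ratPoint c`**: in `S/ratPoint c` the `q`-th powers `ξ_i^q` of the coordinates are `k`-proportional
to the vector `c` (`cdim = 1` in the dictionary of `MizutaniInvFormsTensor.lean`). [cite: Oda1983HironakaGroupSchemeII, Thm. 3.1 (p. 1173)] -/
theorem C_mul_X_pow_sub_mem_ratPoint (i j : Fin (n + 1)) :
    C (c j) * X i ^ p ^ e - C (c i) * X j ^ p ^ e ∈ ratPoint k p e c := by
  unfold ratPoint
  rw [RingHom.mem_ker, map_sub]
  unfold ratPsi
  rw [map_mul, map_mul, map_pow, map_pow, eval₂Hom_C, eval₂Hom_C, eval₂Hom_X', eval₂Hom_X', RingHom.comp_apply,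
    RingHom.comp_apply, iterateFrobenius_def, iterateFrobenius_def, mul_pow, mul_pow, ← map_pow, ← map_pow, sub_eq_zero]
  rw [← mul_assoc, ← mul_assoc, ← map_mul, ← map_mul, ← mul_pow, ← mul_pow, mul_comm (c j) (c i)]

omit hp [CharP k p] in
/-- In `S/𝔭`, for a prime `𝔭` containing all `c_j X_i^q − c_i X_j^q`: `c_j ξ_i^q = c_i ξ_j^q`. [folklore] -/
theorem mk_C_mul_mk_X_pow_eq {𝔭 : Ideal (MvPolynomial (Fin (n + 1)) k)}
    (h : ∀ i j, C (c j) * X i ^ p ^ e - C (c i) * X j ^ p ^ e ∈ 𝔭) (i j : Fin (n + 1)) :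
    Ideal.Quotient.mk 𝔭 (C (c j)) * Ideal.Quotient.mk 𝔭 (X i) ^ p ^ e =
      Ideal.Quotient.mk 𝔭 (C (c i)) * Ideal.Quotient.mk 𝔭 (X j) ^ p ^ e := by
  rw [← map_pow, ← map_pow, ← map_mul, ← map_mul, Ideal.Quotient.eq]
  exact h i j

/-- `χ_c` on a monomial: `χ_c(a X^m) = a^q · Π_i c_i^{m_i}`. [folklore] -/
theorem ratChi_monomial (m : Fin (n + 1) →₀ ℕ) (a : k) :
    ratChi k p e c (monomial m a) = a ^ p ^ e * ∏ i, c i ^ m i := by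
  unfold ratChi
  rw [eval₂Hom_monomial, iterateFrobenius_def, Finsupp.prod_fintype]
  intro i
  exact pow_zero _

/-- KEY IDENTITY for the characterisation, monomial case: for a prime `𝔭 ∋ c_j X_i^q − c_i X_j^q` and a monomial `a X^m`
of degree `|m|`, `χ_c(a X^m) · ξ_{i₀}^{q |m|} = c_{i₀}^{|m|} · (a ξ^m)^q` in `S/𝔭`. [folklore] -/
theorem ratChi_monomial_mul_pow_eq {𝔭 : Ideal (MvPolynomial (Fin (n + 1)) k)}
    (h : ∀ i j, C (c j) * X i ^ p ^ e - C (c i) * X j ^ p ^ e ∈ 𝔭) (i₀ : Fin (n + 1))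
    (m : Fin (n + 1) →₀ ℕ) (a : k) :
    Ideal.Quotient.mk 𝔭 (C (ratChi k p e c (monomial m a))) * Ideal.Quotient.mk 𝔭 (X i₀) ^ (p ^ e * m.degree) =
      Ideal.Quotient.mk 𝔭 (C (c i₀)) ^ m.degree * Ideal.Quotient.mk 𝔭 (monomial m a) ^ p ^ e := by
  set π := Ideal.Quotient.mk 𝔭 with hπ
  have hm : (monomial m a : MvPolynomial (Fin (n + 1)) k) = C a * ∏ i, X i ^ m i := by
    rw [monomial_eq, Finsupp.prod_fintype]
    intro i
    exact pow_zero _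
  have hij : ∀ i, π (C (c i)) * π (X i₀) ^ p ^ e = π (C (c i₀)) * π (X i) ^ p ^ e := fun i =>
    mk_C_mul_mk_X_pow_eq h i₀ i
  rw [ratChi_monomial, hm, Finsupp.degree_eq_sum]
  simp only [map_mul, map_pow, map_prod]
  -- both sides equal `π(C a)^q · Π_i (π(C c_i) · ξ_{i₀}^q)^{m_i}` resp. `π(C a)^q · Π_i (π(C c_{i₀}) · ξ_i^q)^{m_i}`
  have e1 : π (X i₀) ^ (p ^ e * ∑ i, m i) = ∏ i, (π (X i₀) ^ p ^ e) ^ m i := by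
    rw [pow_mul, Finset.prod_pow_eq_pow_sum]
  have e2 : (∏ i, π (X i) ^ m i) ^ p ^ e = ∏ i, (π (X i) ^ p ^ e) ^ m i := by
    rw [← Finset.prod_pow]
    refine Finset.prod_congr rfl fun i _ => ?_
    rw [← pow_mul, ← pow_mul, mul_comm]
  have e3 : π (C (c i₀)) ^ (∑ i, m i) = ∏ i, π (C (c i₀)) ^ m i := (Finset.prod_pow_eq_pow_sum _ _ _).symm
  rw [e1, mul_pow, e2, e3, mul_assoc, ← Finset.prod_mul_distrib, mul_left_comm, ← Finset.prod_mul_distrib]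
  congr 1
  refine Finset.prod_congr rfl fun i _ => ?_
  rw [← mul_pow, ← mul_pow, hij i]

/-- KEY IDENTITY: for a homogeneous `f` of degree `d` and a prime `𝔭 ∋ c_j X_i^q − c_i X_j^q`,
**`χ_c(f) · ξ_{i₀}^{q d} = c_{i₀}^d · f(ξ)^q`** in `S/𝔭` (Frobenius: `f(ξ)^q = f^{(F^e)}(ξ^q)`, and `c_{i₀} ξ_i^q = c_i ξ_{i₀}^q`). [folklore] -/
theorem ratChi_mul_pow_eq {𝔭 : Ideal (MvPolynomial (Fin (n + 1)) k)}
    (h : ∀ i j, C (c j) * X i ^ p ^ e - C (c i) * X j ^ p ^ e ∈ 𝔭) (i₀ : Fin (n + 1))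
    {f : MvPolynomial (Fin (n + 1)) k} {d : ℕ} (hf : f.IsHomogeneous d) :
    Ideal.Quotient.mk 𝔭 (C (ratChi k p e c f)) * Ideal.Quotient.mk 𝔭 (X i₀) ^ (p ^ e * d) =
      Ideal.Quotient.mk 𝔭 (C (c i₀)) ^ d * Ideal.Quotient.mk 𝔭 f ^ p ^ e := by
  classical
  set π := Ideal.Quotient.mk 𝔭 with hπ
  have hdeg : ∀ m ∈ f.support, m.degree = d := by
    intro m hm
    have := hf (mem_support_iff.mp hm)
    rwa [Finsupp.degree_eq_weight_one]
  have hsum : (∑ v ∈ f.support, monomial v (coeff v f)) ^ p ^ e =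
      ∑ v ∈ f.support, (monomial v (coeff v f)) ^ p ^ e := sum_pow_char_pow p e _ _
  have hrhs : π f ^ p ^ e = ∑ v ∈ f.support, π (monomial v (coeff v f)) ^ p ^ e := by
    conv_lhs => rw [f.as_sum, ← map_pow π, hsum, map_sum]
    exact Finset.sum_congr rfl fun v _ => map_pow π _ _
  rw [hrhs, Finset.mul_sum]
  conv_lhs => rw [f.as_sum]
  rw [map_sum (ratChi k p e c), map_sum C, map_sum π, Finset.sum_mul]
  refine Finset.sum_congr rfl fun m hm => ?_
  rw [← hdeg m hm]
  exact ratChi_monomial_mul_pow_eq h i₀ m (coeff m f)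

omit [CharP k p] in
/-- For a point `𝔭 ∋ c_j X_i^q − c_i X_j^q` with `c_{i₀} ≠ 0`: `X_{i₀} ∉ 𝔭` (otherwise every `X_j^q ∈ 𝔭`, so `𝔭 ⊇ S_+`). [folklore] -/
theorem X_not_mem_of_forall_sub_mem {𝔭 : Ideal (MvPolynomial (Fin (n + 1)) k)} (hP : IsPoint k 𝔭)
    (h : ∀ i j, C (c j) * X i ^ p ^ e - C (c i) * X j ^ p ^ e ∈ 𝔭) {i₀ : Fin (n + 1)} (hi₀ : c i₀ ≠ 0) :
    (X i₀ : MvPolynomial (Fin (n + 1)) k) ∉ 𝔭 := by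
  intro hX
  haveI := hP.1
  apply hP.2.2
  refine irrelevant_le_of_X_mem k fun j => ?_
  -- `C(c_{i₀}) X_j^q = C(c_j) X_{i₀}^q − (C(c_j) X_{i₀}^q − C(c_{i₀}) X_j^q) ∈ 𝔭`
  have h1 : C (c j) * X i₀ ^ p ^ e ∈ 𝔭 :=
    Ideal.mul_mem_left _ _ (Ideal.pow_mem_of_mem 𝔭 hX _ (pow_pos hp.out.pos e))
  have h2 : C (c i₀) * X j ^ p ^ e ∈ 𝔭 := by
    have := Ideal.sub_mem 𝔭 h1 (h i₀ j)
    rwa [sub_sub_cancel] at this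
  have hunit : IsUnit (C (c i₀) : MvPolynomial (Fin (n + 1)) k) := IsUnit.map C (Ne.isUnit hi₀)
  have h3 : X j ^ p ^ e ∈ 𝔭 := by
    obtain ⟨v, hv⟩ := hunit
    have := Ideal.mul_mem_left 𝔭 (↑v⁻¹ : MvPolynomial (Fin (n + 1)) k) h2
    rwa [← hv, ← mul_assoc, Units.inv_mul, one_mul] at this
  exact hP.1.mem_of_pow_mem _ h3

/-- **CHARACTERISATION OF THE `k^{1/q}`-RATIONAL POINTS**: a point `𝔭` of `ℙ^n_k` whose coordinates satisfy
`c_j ξ_i^q = c_i ξ_j^q` for all `i, j` (i.e. the `ξ_i^q` are `k`-proportional to the nonzero vector `c`; `cdim = 1`) IS the point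
`ratPoint k p e c = [c_0^{1/q} : ⋯ : c_n^{1/q}]`. [cite: Oda1983HironakaGroupSchemeII, Thm. 3.1 (p. 1173: the point attached to φ); Mizutani1973HironakaGroupSchemes, Thm. 1.3 (the most generic point)] -/
theorem eq_ratPoint_of_forall_sub_mem {𝔭 : Ideal (MvPolynomial (Fin (n + 1)) k)} (hP : IsPoint k 𝔭) (hc : c ≠ 0)
    (h : ∀ i j, C (c j) * X i ^ p ^ e - C (c i) * X j ^ p ^ e ∈ 𝔭) : 𝔭 = ratPoint k p e c := by
  classical
  haveI := hP.1
  obtain ⟨i₀, hi₀⟩ : ∃ i, c i ≠ 0 := by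
    by_contra hn
    push Not at hn
    exact hc (funext hn)
  have hX := X_not_mem_of_forall_sub_mem hP h hi₀
  set π := Ideal.Quotient.mk 𝔭 with hπ
  have hπX : π (X i₀) ≠ 0 := fun h0 => hX (Ideal.Quotient.eq_zero_iff_mem.mp h0)
  have hπc : π (C (c i₀)) ≠ 0 := by
    intro h0
    rw [Ideal.Quotient.eq_zero_iff_mem] at h0
    exact hP.1.ne_top (Ideal.eq_top_of_isUnit_mem _ h0 (IsUnit.map C (Ne.isUnit hi₀)))
  -- homogeneous pieces: `g ∈ 𝔭 ↔ g ∈ ratPoint c` for `g` homogeneous of degree `d`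
  have key : ∀ {g : MvPolynomial (Fin (n + 1)) k} {d : ℕ}, g.IsHomogeneous d → (g ∈ 𝔭 ↔ g ∈ ratPoint k p e c) := by
    intro g d hg
    have hid := ratChi_mul_pow_eq h i₀ hg
    rw [mem_ratPoint_iff_of_isHomogeneous hg, ← Ideal.Quotient.eq_zero_iff_mem]
    constructor
    · intro hg0
      rw [← hπ, hg0, zero_pow (pow_ne_zero _ hp.out.ne_zero), mul_zero, mul_eq_zero] at hid
      rcases hid with h0 | h0
      · rw [Ideal.Quotient.eq_zero_iff_mem] at h0
        by_contra hne
        exact hP.1.ne_top (Ideal.eq_top_of_isUnit_mem _ h0 (IsUnit.map C (Ne.isUnit hne)))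
      · exact absurd (eq_zero_of_pow_eq_zero h0) hπX
    · intro hχ
      rw [hχ, C_0, map_zero, zero_mul, eq_comm, mul_eq_zero] at hid
      rcases hid with h0 | h0
      · exact absurd (eq_zero_of_pow_eq_zero h0) hπc
      · exact eq_zero_of_pow_eq_zero h0
  ext f
  constructor
  · intro hf
    rw [← sum_homogeneousComponent f]
    exact Ideal.sum_mem _ fun d _ =>
      (key (homogeneousComponent_isHomogeneous d f)).mp (hP.2.1 f hf d)
  · intro hf
    rw [← sum_homogeneousComponent f]
    exact Ideal.sum_mem _ fun d _ =>
      (key (homogeneousComponent_isHomogeneous d f)).mpr (homogeneousComponent_mem_ratPoint hf d)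

end Characterisation

/-! ## DUALITY: `Σ a_i X_i^q` is invariant for `[c^{1/q}]` iff `Σ c_i X_i^q` is invariant for `[a^{1/q}]` -/

section Duality

variable {k : Type u} [Field k] {p e : ℕ} [hp : Fact p.Prime] [CharP k p] {n : ℕ}

/-- **DUALITY OF INVARIANT ADDITIVE FORMS** (Mizutani's dual H-scheme `H ↔ H*`, Def. 2.2 / Prop. 2.5, for `k^{1/q}`-rational
points): for all vectors `a, c ∈ k^{n+1}` and every level `e`,
`a ∈ (L_B)_e(ratPoint k p e c) ↔ c ∈ (L_B)_e(ratPoint k p e a)` — both say `Σ_i a_i ⊗ c_i ∈ J^q ⊂ k ⊗_{k^q} k`, and `J^q` is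
stable under the flip. [cite: Mizutani1973HironakaGroupSchemes, Def. 2.2 and Prop. 2.5 (the dual H-scheme H* = H(V*, W*))] -/
theorem mem_invForms_ratPoint_comm (a c : Fin (n + 1) → k) :
    a ∈ invForms k p (ratPoint k p e c) e ↔ c ∈ invForms k p (ratPoint k p e a) e := by
  rw [mem_invForms_ratPoint_iff_zero, mem_invForms_ratPoint_iff_zero,
    ← comm_mem_ideal_pow_iff (p ^ e) (∑ i, c i ⊗ₜ[frobPow k p e] a i), map_sum]
  simp only [Algebra.TensorProduct.comm_tmul]

/-- The same duality one Frobenius twist up: `a ∈ (L_B)_{e+m}(ratPoint_e c) ↔ c^{[p^m]} ∈ (L_B)_{e+m}(ratPoint_{e+m} a)`.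
[cite: Mizutani1973HironakaGroupSchemes, Prop. 2.5 and Lemma 2.7] -/
theorem mem_invForms_ratPoint_comm' (m : ℕ) (a c : Fin (n + 1) → k) :
    a ∈ invForms k p (ratPoint k p e c) (e + m) ↔ frobVec k p m c ∈ invForms k p (ratPoint k p (e + m) a) (e + m) := by
  rw [mem_invForms_ratPoint_iff, mem_invForms_ratPoint_iff_zero,
    ← comm_mem_ideal_pow_iff (p ^ (e + m)) (∑ i, frobVec k p m c i ⊗ₜ[frobPow k p (e + m)] a i), map_sum]
  unfold ratBeta frobVec
  simp only [Algebra.TensorProduct.comm_tmul]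

/-- **Self-duality of Mizutani's example**: the coordinate vector `attC u` of the point of `H_e` is an invariant form of the point
`[a⁰^{1/q}]` of its own invariant form `a⁰ = attA0 u` (and vice versa, `GenAtt.attA0_mem_invForms`).
[cite: Mizutani1973HironakaGroupSchemes, Example 2.1 and Prop. 2.5] -/
theorem attC_mem_invForms_ratPoint_attA0 (u : Fin 2 → k) :
    GenAtt.attC k p e u ∈ invForms k p (ratPoint k p e (GenAtt.attA0 k p e u)) e := by
  rw [← mem_invForms_ratPoint_comm, ← GenAtt.attP_eq_ratPoint]
  exact GenAtt.attA0_mem_invForms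

end Duality

end Summit.ResolutionOfSingularities.KangarooAtlas.Mizutani

end
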